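import Summits.BirchSwinnertonDyer.BirchSwinnertonDyer.Theses.ResidualThetaTransportAtTwo
import Summits.BirchSwinnertonDyer.BirchSwinnertonDyer.Theorems.ResidualThetaTransportAtTwoSignedMuVanishingAtTwoPlusAnalyticAtW
import Summits.BirchSwinnertonDyer.BirchSwinnertonDyer.Theorems.ResidualThetaTransportAtTwoSignedMuVanishingAtTwoPlusResidual
import Summits.BirchSwinnertonDyer.BirchSwinnertonDyer.Theorems.ByReductionTypeAtTwoSupersingularSharpTwo
import Literature.NumberTheory.EllipticCurves.IwasawaAlgebraMuVanishingProofs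
import Literature.NumberTheory.EllipticCurves.IwasawaSelmerProofs
import Literature.NumberTheory.EllipticCurves.AnalyticRankOrderProofs
import Literature.NumberTheory.EllipticCurves.CuspFormLFunctionAnalyticRankProofs
import Literature.NumberTheory.DiophantineGeometry.Conductor
import HarnessLib

/-!
# Route `ResidualThetaTransportAtTwo`, crux Kμ⁺ `SignedMuVanishingAtTwoPlus` (stmt-BirchSwinnertonDyer-20689),
# line `birth` v3, stub `stub_signedResidualFiniteAtTwo` (the algebraic half): the KATO BRIDGE —
# «X⁺ torsion ∧ μ(X⁺) = 0» ⟸ «Kato's signed divisibility at 2 WITHOUT a power of 2» ∧ «2 ∤ L♭» (∧ period unit),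
# and conversely: granted the route item K3 `SignedKatoDivisibilityUpToAtTwo`, the algebraic half in the
# canonical cyclotomic variable IS the statement that K3 holds with exponent `m = 0`

Cell `bsd-wall`, width seat `bsd-wall-rtt-p4-w3` (helper; THEOREMS ONLY — no `def`, no named fact, no `sorry`;
every research input is an inline hypothesis; nothing about any curve is asserted; BSD is not proved by this).

The line `birth` reads the algebraic conjunct of Kμ⁺ («every finitely generated `+` signed Selmer dual `X⁺` of a
habitat⁺ curve over `ℚ_∞` at `2` is `Λ`-torsion with `μ = 0`») as residual finiteness and, on the ledger, as
seed 21438 + propagation 21439/22891 (Greenberg–Vatsal transport; no printed mechanism at `p = 2`). This file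
records the OTHER printed road to `μ_alg = 0` — through the analytic side, which the line already controls:

* (KATO-INT@2) for a datum `D` and a Pollack pair `(L♯, L♭)` at `2`: `X⁺` is torsion and `Char X⁺ = (g)` with
  `g·h = ϖ·L♭` for some `h ∈ Λ` — Kobayashi 2003 Thm. 1.3 (i) («`(L_p^±) ⊆ Char(X^±)`», Kato's Euler-system
  divisibility through the signed Coleman map, printed for odd `p` under surjectivity of `ρ_{E,p}`), i.e. the
  route item K3 `SignedKatoDivisibilityUpToAtTwo` (stmt-20308; `g·h = 2^m·ϖ·L♭`) with `m = 0`;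
* (FLAT) `2 ∤ L♭` (the line's stub 3, per-class certifiable) and (PER) `|ϖ|₂ = 1` (stub 2, Abbes–Ullmo).
Then `μ(X⁺) ≤ μ(ϖ L♭) = 0` (`§1`, pure `Λ`-algebra over the tree's structure theory:
`muInvariant_eq_zero_iff_not_C_dvd_of_charIdeal_eq_span`). Conversely, if `μ(X⁺) = 0` then the `2^m` of K3 divides
`h` (`2` is prime in `Λ`, `IwasawaAlgebra.prime_C`), so K3 holds with `m = 0` (`§1`,
`exists_mul_eq_units_mul_of_mul_eq_C_pow_mul_of_not_C_dvd`). Hence (`§3`), GRANTED K3 + (PER) + (FLAT), the algebraic half of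
Kμ⁺ in the canonical cyclotomic variable ⟺ KATO-INT@2 — ONE research statement in Kato's currency in place of
seed + propagation. `§4`: the binder `γ` of conjunct 1 is idle once `κ` is fixed (all topological generators of
one `κ` act identically on `H¹(ℚ_∞, W[2^∞])`: inner automorphisms, `conjH1_of_mem_holds`), so the canonical-variable
form covers every topological generator of the canonically normalised `κ`.
HONEST GAP: conjunct 1 of the crux also ranges over the NON-canonically normalised cyclotomic `κ` (unit twists,
Washington §13.1), whose data differ from the canonical ones by the `Λ`-automorphism `T ↦ (1+T)^u − 1`
(`μ`-preserving); that transport is not kernel-proved here, so `§3` concludes the algebraic half for pairs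
`(κ, γ)` with `IsCyclotomicVariable 2 γ` — the binder shape of K3, K4 and `KobayashiMainConjecture`.
-- TODO(general form): transport torsion ∧ μ = 0 along `ZpExtension.unitTwist` to reach conjunct 1 verbatim.

References: [Kobayashi2003] Thm. 1.2, Thm. 1.3 (i); [Kato2004Asterisque] Thm. 12.5, 17.4; [Pollack2003] Prop.
6.18; [GreenbergVatsal2000] p. 2 (1)–(2); [Washington1997] §13.1–13.2; [SerreLocalFields1979] VII.§5 Prop. 3.
-/

set_option autoImplicit false
set_option linter.dupNamespace false

noncomputable section

open scoped Classical MatrixGroups ModularForm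

open CongruenceSubgroup WeierstrassCurve Literature.NumberTheory.EllipticCurves
  Literature.NumberTheory.EllipticCurves.ModularForms Literature.NumberTheory.EllipticCurves.Rank1Residual
  Literature.NumberTheory.EllipticCurves.Kobayashi2003 Literature.NumberTheory.EllipticCurves.IwasawaAlgebra
  Summit.BirchSwinnertonDyer.Rank1Residual.Supersingular Summit.BirchSwinnertonDyer.Rank1Residual.X1
  Summit.BirchSwinnertonDyer.BirchSwinnertonDyer.Theses.ResidualThetaTransportAtTwo

namespace Summit.BirchSwinnertonDyer.BirchSwinnertonDyer.Theorems.SignedMuAtTwo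

universe u

/-! ## §1. `Λ`-algebra: `μ(X) = 0` from a `p`-free multiple of the characteristic generator, and back -/

section Algebra

variable {p : ℕ} [Fact p.Prime]

/-- **`μ(X) = 0` from an integral divisibility**: if `X` is a finitely generated torsion `Λ`-module with
`Char X = (g)` and `g·h = u·L` with `u ∈ ℤ_pˣ` and `p ∤ L`, then `μ(X) = 0` (`p ∣ g ⇒ p ∣ g h = u L ⇒ p ∣ L`).
[cite: Washington1997, §13.2] [cite: GreenbergVatsal2000, p. 2, (1)–(2)] -/
theorem muInvariant_eq_zero_of_charIdeal_eq_span_of_mul_eq_units_mul_of_not_C_dvd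
    (X : Type*) [AddCommGroup X] [Module (IwasawaAlgebra p) X] [Module.Finite (IwasawaAlgebra p) X]
    (hX : Module.IsTorsion (IwasawaAlgebra p) X) {g h L : IwasawaAlgebra p} (u : ℤ_[p]ˣ)
    (hg : Literature.NumberTheory.EllipticCurves.Module.charIdeal (IwasawaAlgebra p) X = Ideal.span {g})
    (hgh : g * h = PowerSeries.C (u : ℤ_[p]) * L) (hL : ¬ PowerSeries.C (p : ℤ_[p]) ∣ L) :
    muInvariant p X = 0 := by
  rw [muInvariant_eq_zero_iff_not_C_dvd_of_charIdeal_eq_span X hX hg]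
  intro hpg
  apply hL
  have h1 : PowerSeries.C (p : ℤ_[p]) ∣ PowerSeries.C (u : ℤ_[p]) * L := by
    rw [← hgh]; exact hpg.mul_right h
  exact (C_dvd_C_units_mul_iff u L).mp h1

/-- **Descent of the exponent**: if `g·h = p^m·(u·L)` in `Λ` and `p ∤ g`, then `p^m ∣ h` and `g·h' = u·L`
for `h' = h/p^m` (`p` is prime in `Λ`, `IwasawaAlgebra.prime_C`; `Λ` is a domain). The `Λ`-form (unit `u ∈ ℤ_pˣ`)
of the sibling route's `ThetaPartnerXRoute.exists_mul_eq_of_mul_eq_C_pow_mul_of_not_C_dvd` (stated there through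
`ι : Λ → ℚ_p⟦T⟧` with a `p`-integral rational `ϖ`; not imported to keep this file out of the TP2 theses cone).
[cite: Washington1997, §13.1] -/
theorem exists_mul_eq_units_mul_of_mul_eq_C_pow_mul_of_not_C_dvd {g h L : IwasawaAlgebra p} {m : ℕ} (u : ℤ_[p]ˣ)
    (hgh : g * h = PowerSeries.C ((p : ℤ_[p]) ^ m) * (PowerSeries.C (u : ℤ_[p]) * L))
    (hg : ¬ PowerSeries.C (p : ℤ_[p]) ∣ g) :
    ∃ h' : IwasawaAlgebra p, g * h' = PowerSeries.C (u : ℤ_[p]) * L := by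
  induction m generalizing h with
  | zero => exact ⟨h, by rw [hgh, pow_zero, map_one, one_mul]⟩
  | succ m ih =>
    -- `p ∣ g h`, `p ∤ g` ⇒ `p ∣ h`
    have hp : Prime (PowerSeries.C (p : ℤ_[p]) : IwasawaAlgebra p) := IwasawaAlgebra.prime_C p
    have hdvd : PowerSeries.C (p : ℤ_[p]) ∣ g * h := by
      rw [hgh, pow_succ, map_mul, mul_assoc, mul_comm (PowerSeries.C ((p : ℤ_[p]) ^ m)), mul_assoc]
      exact dvd_mul_right _ _
    obtain ⟨h₁, rfl⟩ := (hp.dvd_or_dvd hdvd).resolve_left hg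
    refine ih (h := h₁) ?_
    have hC0 : (PowerSeries.C (p : ℤ_[p]) : IwasawaAlgebra p) ≠ 0 := hp.ne_zero
    apply mul_left_cancel₀ hC0
    calc PowerSeries.C (p : ℤ_[p]) * (g * h₁) = g * (PowerSeries.C (p : ℤ_[p]) * h₁) := by ring
      _ = PowerSeries.C ((p : ℤ_[p]) ^ (m + 1)) * (PowerSeries.C (u : ℤ_[p]) * L) := hgh
      _ = PowerSeries.C (p : ℤ_[p]) * (PowerSeries.C ((p : ℤ_[p]) ^ m) * (PowerSeries.C (u : ℤ_[p]) * L)) := by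
          rw [pow_succ, map_mul]; ring

end Algebra

/-! ## §2. One datum at `2`: KATO-INT ∧ `|ϖ|₂ = 1` ∧ `2 ∤ L♭` ⇒ torsion ∧ `μ = 0` (∧ `X⁺/2X⁺` finite) -/

section Datum

variable {W : WeierstrassCurve ℚ} {κ : ZpExtension ℚ 2} {γ : Field.absoluteGaloisGroup ℚ}

/-- **Datum-wise Kato bridge at `2`**: for a `+` signed Selmer dual datum `D` with `X = D.X` finitely generated,
if `X` is torsion with `Char X = (g)`, `ι(g·h) = ϖ · ι(L^+_W)` (`L^+_W = kobayashiL 1 L♯ L♭ = L♭`) for a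
rational `2`-adic unit `ϖ`, and `2 ∤ L♭`, then `X` is torsion with `μ(X) = 0`.
[cite: Kobayashi2003, Thm. 1.3 (i)] [cite: Washington1997, §13.2] -/
theorem isTorsion_and_mu_eq_zero_of_integralKato_of_not_two_dvd (D : SignedSelmerDualData W κ γ 1)
    [Module.Finite (IwasawaAlgebra 2) D.X] (hT : Module.IsTorsion (IwasawaAlgebra 2) D.X)
    {ϖ : ℚ} (hϖ1 : ‖(ϖ : ℚ_[2])‖ = 1) {Lplus Lminus g h : IwasawaAlgebra 2}
    (hg : D.charIdeal = Ideal.span {g})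
    (hgh : iwasawaToPowerSeries 2 (g * h) =
      PowerSeries.C (ϖ : ℚ_[2]) * iwasawaToPowerSeries 2 (kobayashiL 1 Lplus Lminus))
    (hflat : ¬ PowerSeries.C (2 : ℤ_[2]) ∣ Lminus) :
    Module.IsTorsion (IwasawaAlgebra 2) D.X ∧ D.mu = 0 := by
  refine ⟨hT, ?_⟩
  obtain ⟨u, hu⟩ := exists_units_coe_eq_of_norm_ratCast_eq_one (p := 2) hϖ1
  have hk : kobayashiL (p := 2) 1 Lplus Lminus = Lminus := by unfold kobayashiL; rw [if_pos rfl]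
  rw [hk, ← hu] at hgh
  have hgh' : g * h = PowerSeries.C ((2 : ℤ_[2]) ^ 0) * (PowerSeries.C (u : ℤ_[2]) * Lminus) :=
    eq_C_pow_mul_of_map_eq (p := 2) (m := 0) u (by rw [pow_zero, one_mul]; exact_mod_cast hgh)
  rw [pow_zero, map_one, one_mul] at hgh'
  have h := muInvariant_eq_zero_of_charIdeal_eq_span_of_mul_eq_units_mul_of_not_C_dvd (p := 2) D.X hT u hg
    hgh' (by simpa using hflat)
  exact h

/-- The same in RESIDUAL currency (the line's stub 1 at this datum): `X⁺/2X⁺` is finite.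
[cite: Kobayashi2003, Thm. 1.3 (i)] [cite: GreenbergVatsal2000, p. 3 (proof of Thm. (1.4))] -/
theorem finite_quotient_of_integralKato_of_not_two_dvd (D : SignedSelmerDualData W κ γ 1)
    [Module.Finite (IwasawaAlgebra 2) D.X] (hT : Module.IsTorsion (IwasawaAlgebra 2) D.X)
    {ϖ : ℚ} (hϖ1 : ‖(ϖ : ℚ_[2])‖ = 1) {Lplus Lminus g h : IwasawaAlgebra 2}
    (hg : D.charIdeal = Ideal.span {g})
    (hgh : iwasawaToPowerSeries 2 (g * h) =
      PowerSeries.C (ϖ : ℚ_[2]) * iwasawaToPowerSeries 2 (kobayashiL 1 Lplus Lminus))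
    (hflat : ¬ PowerSeries.C (2 : ℤ_[2]) ∣ Lminus) :
    Finite (D.X ⧸ (augIdealP 2 • ⊤ : Submodule (IwasawaAlgebra 2) D.X)) :=
  (isTorsion_and_mu_eq_zero_iff_finite_quotient D).mp
    (isTorsion_and_mu_eq_zero_of_integralKato_of_not_two_dvd D hT hϖ1 hg hgh hflat)

/-- **Converse at one datum**: if `X` is torsion with `μ(X) = 0` and K3 holds at `D` — `Char X = (g)`,
`ι(g·h) = 2^m·ϖ·ι(L^+_W)` — then K3 holds with `m = 0`: `ι(g·h') = ϖ·ι(L^+_W)` for some `h'`.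
[cite: Kobayashi2003, Thm. 1.3 (i)] [cite: Washington1997, §13.1–13.2] -/
theorem exists_integralKato_of_mu_eq_zero_of_upTo (D : SignedSelmerDualData W κ γ 1)
    [Module.Finite (IwasawaAlgebra 2) D.X] (hT : Module.IsTorsion (IwasawaAlgebra 2) D.X) (hμ : D.mu = 0)
    {ϖ : ℚ} (hϖ1 : ‖(ϖ : ℚ_[2])‖ = 1) {Lplus Lminus g h : IwasawaAlgebra 2} {m : ℕ}
    (hg : D.charIdeal = Ideal.span {g})
    (hgh : iwasawaToPowerSeries 2 (g * h) =
      PowerSeries.C ((2 : ℚ_[2]) ^ m * (ϖ : ℚ_[2])) * iwasawaToPowerSeries 2 (kobayashiL 1 Lplus Lminus)) :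
    ∃ h' : IwasawaAlgebra 2, iwasawaToPowerSeries 2 (g * h') =
      PowerSeries.C (ϖ : ℚ_[2]) * iwasawaToPowerSeries 2 (kobayashiL 1 Lplus Lminus) := by
  obtain ⟨u, hu⟩ := exists_units_coe_eq_of_norm_ratCast_eq_one (p := 2) hϖ1
  set L := kobayashiL (p := 2) 1 Lplus Lminus with hLdef
  rw [← hu] at hgh
  have hgh' : g * h = PowerSeries.C ((2 : ℤ_[2]) ^ m) * (PowerSeries.C (u : ℤ_[2]) * L) :=
    eq_C_pow_mul_of_map_eq (p := 2) (m := m) u (by exact_mod_cast hgh)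
  have hng : ¬ PowerSeries.C (2 : ℤ_[2]) ∣ g := by
    have h1 := (muInvariant_eq_zero_iff_not_C_dvd_of_charIdeal_eq_span D.X hT hg).mp hμ
    simpa using h1
  obtain ⟨h', hh'⟩ := exists_mul_eq_units_mul_of_mul_eq_C_pow_mul_of_not_C_dvd (p := 2) u
    (by simpa using hgh') (by simpa using hng)
  refine ⟨h', ?_⟩
  rw [hh', map_mul, ← hu]
  congr 1
  simp [iwasawaToPowerSeries]

end Datum

/-! ## §3. The habitat⁺, canonical cyclotomic variable: KATO-INT@2 ∧ (PER) ∧ (FLAT) ⇒ algebraic half; and ⟺ granted K3 -/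

section Habitat

/-- **The algebraic half of Kμ⁺ in the canonical cyclotomic variable from KATO-INT@2 ∧ (PER) ∧ (FLAT)**
(modularity `exists_isNewformOf` supplies the newform; Sprung's pair supplies a Pollack pair at `2`,
`exists_isPollackPair_two`; the period unit supplies `ϖ = u⁻¹`). KATO-INT@2 is spelled as the route item K3
`SignedKatoDivisibilityUpToAtTwo` with exponent `m = 0` plus torsion (Kobayashi Thm. 1.2 + Thm. 1.3 (i) shape at
`p = 2`; research at `2`). [cite: Kobayashi2003, Thm. 1.2 and Thm. 1.3 (i)] [cite: Kato2004Asterisque, Thm. 17.4]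
[cite: Pollack2003, Prop. 6.18] [cite: Sprung2017, Cor. 4.4] -/
theorem muAlgebraicCanonical_of_integralKato_of_periodUnit_of_flatMuZero (hnf : exists_isNewformOf)
    (hKato : ∀ (W : WeierstrassCurve ℚ) [W.IsElliptic] [W.IsGloballyMinimal], ¬ W.HasCM → W.analyticRank = 0 →
      GoodSS W 2 → W.frobeniusTrace 2 = 0 → W.Δ < 0 →
      ∀ (κ : ZpExtension ℚ 2) (γ : Field.absoluteGaloisGroup ℚ), κ.IsCyclotomic → κ.IsTopGenerator γ →
      IsCyclotomicVariable 2 γ →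
      ∀ [NeZero (W.conductorNorm ℤ)] (f : CuspForm (Gamma0 (W.conductorNorm ℤ)) 2), IsNewformOf W f →
      ∀ (ϖ : ℚ), (ϖ : ℝ) * W.realPeriodRat = plusPeriod f →
      ∀ (Lplus Lminus : IwasawaAlgebra 2), IsPollackPair f 2 Lplus Lminus →
      ∀ (D : SignedSelmerDualData W κ γ 1), Module.IsTorsion (IwasawaAlgebra 2) D.X ∧
        ∃ g h : IwasawaAlgebra 2, D.charIdeal = Ideal.span {g} ∧
          iwasawaToPowerSeries 2 (g * h) =
            PowerSeries.C (ϖ : ℚ_[2]) * iwasawaToPowerSeries 2 (kobayashiL 1 Lplus Lminus))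
    (hper : ∀ (W : WeierstrassCurve ℚ) [W.IsElliptic] [W.IsGloballyMinimal], GoodSS W 2 →
      ∀ [NeZero (W.conductorNorm ℤ)] (f : CuspForm (Gamma0 (W.conductorNorm ℤ)) 2), IsNewformOf W f →
      ∃ u : ℚ, ‖(u : ℚ_[2])‖ = 1 ∧ W.realPeriodRat = u * plusPeriod f)
    (hflat : ∀ (W : WeierstrassCurve ℚ) [W.IsElliptic] [W.IsGloballyMinimal], ¬ W.HasCM →
      W.analyticRank = 0 → GoodSS W 2 → W.frobeniusTrace 2 = 0 → W.Δ < 0 →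
      ∀ [NeZero (W.conductorNorm ℤ)] (f : CuspForm (Gamma0 (W.conductorNorm ℤ)) 2), IsNewformOf W f →
      ∀ (Lplus Lminus : IwasawaAlgebra 2), IsPollackPair f 2 Lplus Lminus →
      ¬ PowerSeries.C (2 : ℤ_[2]) ∣ Lminus) :
    ∀ (W : WeierstrassCurve ℚ) [W.IsElliptic] [W.IsGloballyMinimal], ¬ W.HasCM → W.analyticRank = 0 →
      GoodSS W 2 → W.frobeniusTrace 2 = 0 → W.Δ < 0 →
      ∀ (κ : ZpExtension ℚ 2) (γ : Field.absoluteGaloisGroup ℚ), κ.IsCyclotomic → κ.IsTopGenerator γ →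
      IsCyclotomicVariable 2 γ →
      ∀ (D : SignedSelmerDualData W κ γ 1) [Module.Finite (IwasawaAlgebra 2) D.X],
        Module.IsTorsion (IwasawaAlgebra 2) D.X ∧ D.mu = 0 := by
  intro W _ _ hCM hr hss ha hΔ κ γ hκ hγ hγ' D _
  haveI : NeZero (W.conductorNorm ℤ) := ⟨(W.conductorNorm_pos_holds).ne'⟩
  obtain ⟨f, hf⟩ := hnf W
  -- the period ratio `ϖ = u⁻¹`, a `2`-adic unit
  obtain ⟨u, hu1, hΩ⟩ := hper W hss f hf
  have hΩpos : 0 < W.realPeriodRat := W.realPeriodRat_pos_holds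
  have hu0 : u ≠ 0 := by rintro rfl; simp at hu1
  have hu0' : (u : ℝ) ≠ 0 := by exact_mod_cast hu0
  have hϖ : ((u⁻¹ : ℚ) : ℝ) * W.realPeriodRat = plusPeriod f := by
    rw [hΩ, Rat.cast_inv, ← mul_assoc, inv_mul_cancel₀ hu0', one_mul]
  have hϖ1 : ‖((u⁻¹ : ℚ) : ℚ_[2])‖ = 1 := by rw [Rat.cast_inv, norm_inv, hu1, inv_one]
  -- a Pollack pair at `2` exists (Sprung's pair; `L(W,1) ≠ 0` from `r_an = 0`)
  have hL : W.entireLFunction 1 ≠ 0 :=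
    (WeierstrassCurve.analyticRank_eq_zero_iff_holds (W := W) hf.hasEntireLFunction).mp hr
  obtain ⟨Ls, Lf, -, hP⟩ := exists_isPollackPair_two hf hss.1 ha hL
  obtain ⟨hT, g, h, hg, hgh⟩ := hKato W hCM hr hss ha hΔ κ γ hκ hγ hγ' f hf (u⁻¹) hϖ Ls Lf hP D
  exact isTorsion_and_mu_eq_zero_of_integralKato_of_not_two_dvd D hT hϖ1 hg hgh
    (hflat W hCM hr hss ha hΔ f hf Ls Lf hP)

/-- **GRANTED the route item K3 `SignedKatoDivisibilityUpToAtTwo` (by name), (PER) and (FLAT): the algebraic half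
of Kμ⁺ in the canonical variable ⟺ KATO-INT@2** (K3 with exponent `0` plus torsion). So on the ledger the seed +
propagation pair (21438, 21439/22891) and «K3 holds integrally» are interchangeable research inputs for the
canonical-variable part of conjunct 1. [cite: Kobayashi2003, Thm. 1.3 (i)] [cite: Kato2004Asterisque, Thm. 17.4]
[cite: Washington1997, §13.1–13.2] -/
theorem muAlgebraicCanonical_iff_integralKato_of_upTo_of_periodUnit_of_flatMuZero
    (hK3 : SignedKatoDivisibilityUpToAtTwo)
    (hper : ∀ (W : WeierstrassCurve ℚ) [W.IsElliptic] [W.IsGloballyMinimal], GoodSS W 2 →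
      ∀ [NeZero (W.conductorNorm ℤ)] (f : CuspForm (Gamma0 (W.conductorNorm ℤ)) 2), IsNewformOf W f →
      ∃ u : ℚ, ‖(u : ℚ_[2])‖ = 1 ∧ W.realPeriodRat = u * plusPeriod f)
    (hflat : ∀ (W : WeierstrassCurve ℚ) [W.IsElliptic] [W.IsGloballyMinimal], ¬ W.HasCM →
      W.analyticRank = 0 → GoodSS W 2 → W.frobeniusTrace 2 = 0 → W.Δ < 0 →
      ∀ [NeZero (W.conductorNorm ℤ)] (f : CuspForm (Gamma0 (W.conductorNorm ℤ)) 2), IsNewformOf W f →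
      ∀ (Lplus Lminus : IwasawaAlgebra 2), IsPollackPair f 2 Lplus Lminus →
      ¬ PowerSeries.C (2 : ℤ_[2]) ∣ Lminus)
    (hnf : exists_isNewformOf) :
    (∀ (W : WeierstrassCurve ℚ) [W.IsElliptic] [W.IsGloballyMinimal], ¬ W.HasCM → W.analyticRank = 0 →
      GoodSS W 2 → W.frobeniusTrace 2 = 0 → W.Δ < 0 →
      ∀ (κ : ZpExtension ℚ 2) (γ : Field.absoluteGaloisGroup ℚ), κ.IsCyclotomic → κ.IsTopGenerator γ →
      IsCyclotomicVariable 2 γ →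
      ∀ (D : SignedSelmerDualData W κ γ 1) [Module.Finite (IwasawaAlgebra 2) D.X],
        Module.IsTorsion (IwasawaAlgebra 2) D.X ∧ D.mu = 0) ↔
    (∀ (W : WeierstrassCurve ℚ) [W.IsElliptic] [W.IsGloballyMinimal], ¬ W.HasCM → W.analyticRank = 0 →
      GoodSS W 2 → W.frobeniusTrace 2 = 0 → W.Δ < 0 →
      ∀ (κ : ZpExtension ℚ 2) (γ : Field.absoluteGaloisGroup ℚ), κ.IsCyclotomic → κ.IsTopGenerator γ →
      IsCyclotomicVariable 2 γ →
      ∀ [NeZero (W.conductorNorm ℤ)] (f : CuspForm (Gamma0 (W.conductorNorm ℤ)) 2), IsNewformOf W f →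
      ∀ (ϖ : ℚ), (ϖ : ℝ) * W.realPeriodRat = plusPeriod f →
      ∀ (Lplus Lminus : IwasawaAlgebra 2), IsPollackPair f 2 Lplus Lminus →
      ∀ (D : SignedSelmerDualData W κ γ 1) [Module.Finite (IwasawaAlgebra 2) D.X],
        Module.IsTorsion (IwasawaAlgebra 2) D.X ∧
        ∃ g h : IwasawaAlgebra 2, D.charIdeal = Ideal.span {g} ∧
          iwasawaToPowerSeries 2 (g * h) =
            PowerSeries.C (ϖ : ℚ_[2]) * iwasawaToPowerSeries 2 (kobayashiL 1 Lplus Lminus)) := by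
  constructor
  · intro halg W _ _ hCM hr hss ha hΔ κ γ hκ hγ hγ' _ f hf ϖ hϖ Lplus Lminus hP D _
    obtain ⟨hT, hμ⟩ := halg W hCM hr hss ha hΔ κ γ hκ hγ hγ' D
    obtain ⟨g, h, m, hg, hgh⟩ := hK3 W hCM hr hss ha κ γ hκ hγ hγ' f hf ϖ hϖ Lplus Lminus hP D
    have hϖ1 : ‖(ϖ : ℚ_[2])‖ = 1 := norm_ratCast_periodRatio_eq_one hϖ (hper W hss f hf)
    obtain ⟨h', hh'⟩ := exists_integralKato_of_mu_eq_zero_of_upTo D hT hμ hϖ1 hg hgh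
    exact ⟨hT, g, h', hg, hh'⟩
  · intro hKato W _ _ hCM hr hss ha hΔ κ γ hκ hγ hγ' D _
    haveI : NeZero (W.conductorNorm ℤ) := ⟨(W.conductorNorm_pos_holds).ne'⟩
    obtain ⟨f, hf⟩ := hnf W
    obtain ⟨u, hu1, hΩ⟩ := hper W hss f hf
    have hu0 : u ≠ 0 := by rintro rfl; simp at hu1
    have hu0' : (u : ℝ) ≠ 0 := by exact_mod_cast hu0
    have hϖ : ((u⁻¹ : ℚ) : ℝ) * W.realPeriodRat = plusPeriod f := by
      rw [hΩ, Rat.cast_inv, ← mul_assoc, inv_mul_cancel₀ hu0', one_mul]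
    have hϖ1 : ‖((u⁻¹ : ℚ) : ℚ_[2])‖ = 1 := by rw [Rat.cast_inv, norm_inv, hu1, inv_one]
    have hL : W.entireLFunction 1 ≠ 0 :=
      (WeierstrassCurve.analyticRank_eq_zero_iff_holds (W := W) hf.hasEntireLFunction).mp hr
    obtain ⟨Ls, Lf, -, hP⟩ := exists_isPollackPair_two hf hss.1 ha hL
    obtain ⟨hT, g, h, hg, hgh⟩ := hKato W hCM hr hss ha hΔ κ γ hκ hγ hγ' f hf (u⁻¹) hϖ Ls Lf hP D
    exact isTorsion_and_mu_eq_zero_of_integralKato_of_not_two_dvd D hT hϖ1 hg hgh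
      (hflat W hCM hr hss ha hΔ f hf Ls Lf hP)

end Habitat

/-! ## §4. The binder `γ` of conjunct 1 is idle once `κ` is fixed -/

section Generator

variable {W : WeierstrassCurve ℚ} {κ : ZpExtension ℚ 2} {γ₀ γ : Field.absoluteGaloisGroup ℚ}

/-- Two topological generators of the same `ℤ_p`-extension act identically on `H¹(K_∞, E[p^∞])`:
`γ = γ₀ · (γ₀⁻¹γ)` with `γ₀⁻¹γ ∈ ker κ`, and inner automorphisms act trivially (`conjH1_of_mem_holds`).
[cite: SerreLocalFields1979, VII.§5 Prop. 3] [cite: Washington1997, §13.1] -/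
theorem conjH1_kerSubgroup_eq_of_isTopGenerator (h₀ : κ.IsTopGenerator γ₀) (h : κ.IsTopGenerator γ) :
    W.conjH1 2 κ.kerSubgroup γ = W.conjH1 2 κ.kerSubgroup γ₀ := by
  haveI : κ.kerSubgroup.Normal := inferInstanceAs (κ.toContinuousMonoidHom.toMonoidHom.ker).Normal
  have hmem : γ₀⁻¹ * γ ∈ κ.kerSubgroup := by
    rw [ZpExtension.mem_kerSubgroup, map_mul, map_inv]
    rw [ZpExtension.IsTopGenerator] at h₀ h
    rw [h₀, h, inv_mul_cancel]
  have hγ : γ = γ₀ * (γ₀⁻¹ * γ) := by group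
  conv_lhs => rw [hγ]
  rw [W.conjH1_mul_holds 2 κ.kerSubgroup γ₀ (γ₀⁻¹ * γ), W.conjH1_of_mem_holds 2 κ.kerSubgroup hmem,
    AddMonoidHom.comp_id]

/-- **The binder `γ` is idle**: if every finitely generated `+` datum for ONE topological generator `γ₀` of `κ`
is torsion with `μ = 0`, then so is every finitely generated `+` datum for ANY topological generator `γ` of
`κ` (the datum for `γ` IS a datum for `γ₀`: same `X`, same `toDual`, `T` acts as `conj_γ − 1 = conj_{γ₀} − 1`).
[cite: Kobayashi2003, Def. 1.1] [cite: SerreLocalFields1979, VII.§5 Prop. 3] -/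
theorem isTorsion_and_mu_eq_zero_of_isTopGenerator (h₀ : κ.IsTopGenerator γ₀) (h : κ.IsTopGenerator γ)
    (halg : ∀ (D : SignedSelmerDualData W κ γ₀ 1) [Module.Finite (IwasawaAlgebra 2) D.X],
      Module.IsTorsion (IwasawaAlgebra 2) D.X ∧ D.mu = 0)
    (D : SignedSelmerDualData W κ γ 1) [hfin : Module.Finite (IwasawaAlgebra 2) D.X] :
    Module.IsTorsion (IwasawaAlgebra 2) D.X ∧ D.mu = 0 := by
  have hconj := conjH1_kerSubgroup_eq_of_isTopGenerator (W := W) h₀ h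
  let D₀ : SignedSelmerDualData W κ γ₀ 1 :=
    { X := D.X
      conj_mem := fun s hs ↦ conjH1_mem_signedSelmerInfty W κ 1 γ₀ hs
      toDual := D.toDual
      bijective := D.bijective
      toDual_T_smul := fun x s ↦ by
        have hs : (⟨W.conjH1 2 κ.kerSubgroup γ₀ ↑s, conjH1_mem_signedSelmerInfty W κ 1 γ₀ s.2⟩ :
            ↥(signedSelmerInfty W κ 1)) = ⟨W.conjH1 2 κ.kerSubgroup γ ↑s, D.conj_mem ↑s s.2⟩ := by
          apply Subtype.ext
          show (W.conjH1 2 κ.kerSubgroup γ₀) ↑s = (W.conjH1 2 κ.kerSubgroup γ) ↑s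
          rw [hconj]
        show D.toDual ((PowerSeries.X : IwasawaAlgebra 2) • x) s =
          D.toDual x ⟨W.conjH1 2 κ.kerSubgroup γ₀ ↑s, conjH1_mem_signedSelmerInfty W κ 1 γ₀ s.2⟩ - D.toDual x s
        rw [hs]
        exact D.toDual_T_smul x s
      toDual_C_smul := D.toDual_C_smul }
  haveI : Module.Finite (IwasawaAlgebra 2) D₀.X := hfin
  exact halg D₀

end Generator

end Summit.BirchSwinnertonDyer.BirchSwinnertonDyer.Theorems.SignedMuAtTwo

end
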